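import Summits.ABC.ABC.Theses.DefiniteXi
import Summits.ABC.ABC.Theorems.DefiniteXiDefiniteRTControlPrime
import Literature.NumberTheory.EllipticCurves.TakahashiDegreeFormulaFromDictionaryHolds
import Literature.NumberTheory.EllipticCurves.TakahashiDegreeFormulaCoprimeProofs
import Literature.NumberTheory.EllipticCurves.DegreeConjectureAbcSemistable
import Literature.NumberTheory.EllipticCurves.DegreeConjectureAbcPrelims
import Literature.NumberTheory.EllipticCurves.FreyHellegouarchNormalizedCurveProofs
import Literature.NumberTheory.EllipticCurves.SzpiroFreyProofs
import Literature.NumberTheory.EllipticCurves.SilvermanHeightCovolumeProofs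
import Literature.NumberTheory.EllipticCurves.ManinConstantArbitraryParametrizationIntegralProofs
import Literature.NumberTheory.EllipticCurves.PastenHeightBoundsLemma68LocalProofs
import Literature.NumberTheory.Automorphic.ShimuraCurveRibetTakahashiSemistableManinProofs
import Literature.NumberTheory.Automorphic.ShimuraCurveRibetTakahashiPairwiseEisensteinProofs
import Literature.NumberTheory.EllipticCurves.IsogenyConductorModularityProofs
import Literature.NumberTheory.EllipticCurves.SzpiroLocalDataProofs
import HarnessLib

/-!
# `stub_takahashi` · ideator k1 · gen 13 — the SUMMIT consumes only the square-free Takahashi fact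

Companion of `Cruxes/DefiniteRTControlPrime/STUB-IDEAS-stub_takahashi-1.md` (gen 13).
Crux `stmt-ABC-11338` = `DefiniteXi.DefiniteRTControlPrime`; registered stub (fixed, untouched):
`theorem stub_takahashi : takahashi2001_thm_2_3_of_coprime` (Takahashi 2001 Thm 2.3 at `r ∥ N`,
cofactor `M` ARBITRARY — the strength needed only by NON-semistable Frey curves, `16 ∤ abc`).

FAMILY 1 (recognise & import), technique "tree match": the tree already holds the folklore
reduction `abcLe_of_abcLe_sixteen_dvd` (abc on triples with `16 ∣ abc` ⇒ abc; auxiliary triple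
`(u⁸, v⁸ − u⁸, v⁸)`) and the semistable passage `abcLe_of_semistableDegreeBound` serving routes
`QuaternionicDegree` / `IsogenyGlueCongruence`.  For `16 ∣ abc` the Serre-arranged Frey curve
(`exists_arrangement`: `4 ∣ A+1`, `16 ∣ B`) has SQUARE-FREE conductor (B3 below), and at square-free
level the Takahashi fact needed is `takahashi2001_thm_2_3`, which follows from the ONE reviewed
dictionary def `takahashi2001_characterGroupDictionary` because rank one is a tree THEOREM
(`takahashi2001_brandtEigenLattice_rank_one_holds`) — B1.  So the arbitrary-cofactor strength of
`stub_takahashi` (k3's `q² ∣ M` Brandt-trace programme, k1-g12's coprime-dictionary typing want,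
k2-g6's "forced" two-additive residual regime) is dispensable for the summit: B2–B6 are the typed
helper lemmas of the re-glue; `sorry` marks exactly the prover work (B2 = port of a kernel-checked
proof, B4/B5 = mechanical clones of landed proofs with one hypothesis made pointwise).
-/

set_option linter.dupNamespace false

noncomputable section

namespace Summit.ABC.ABC.Cruxes.DefiniteRTControlPrime.StubIdeas1G13

open Summit.ABC.ABC.Theses.DefiniteXi
open Literature.NumberTheory.EllipticCurves Literature.NumberTheory.EllipticCurves.ModularForms
open Literature.NumberTheory.Automorphic Literature.NumberTheory.DiophantineGeometry
open IsDedekindDomain WeierstrassCurve NumberField UniqueFactorizationMonoid CongruenceSubgroup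

/-! ## B1 — the square-free Takahashi fact from ONE reviewed def (rank one is a theorem) -/

/-- B1 (PROVED, one line over the tree): Takahashi 2001 Thm 2.3 at square-free level from the
character-group dictionary def; multiplicity one is `takahashi2001_brandtEigenLattice_rank_one_holds`. -/
theorem takahashiSqf_of_dictionary (hD : takahashi2001_characterGroupDictionary) :
    takahashi2001_thm_2_3 :=
  takahashi2001_thm_2_3_holds_of takahashi2001_brandtEigenLattice_rank_one_holds hD

/-- B1′ (PROVED): the registered stub is STRONGER than Plan B's leaf. -/
theorem takahashiSqf_of_stub (h : takahashi2001_thm_2_3_of_coprime) : takahashi2001_thm_2_3 :=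
  takahashi2001_thm_2_3_of_of_coprime h

/-! ## B2 — the crux restricted to square-free Frey conductors: PORT of k2-g6 (verbatim)

The block between the `-- BEGIN PORT` / `-- END PORT` markers is copied VERBATIM from
`Cruxes/DefiniteRTControlPrime/StubIdeas2G6TakahashiSketch.lean` (ideator k2, gen 6: §0 lines 61–123,
§2 lines 319–328 and 372–478; kernel-checked there; `Cruxes/` modules are not built on the farm, so the
decls are re-elaborated here, not imported).  Credit: k2-g6.  Nothing in it is new to this memo. -/

section PortK2G6

open Summit.ABC.ABC.Theorems.DefiniteRTControlPrime
open Literature.NumberTheory.Automorphic.HeckeTraceFormulaGL2Level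
open Literature.NumberTheory.EllipticCurves.BrandtJL
open ArithmeticFunction
open scoped BigOperators ArithmeticFunction.sigma

-- BEGIN PORT (k2-g6)
/-- The stub's statement restricted to cofactors `M` with `good M` (gen 5). -/
def TakahashiCoprimeAt (good : ℕ → Prop) : Prop :=
  ∀ (W : WeierstrassCurve ℚ) [W.IsElliptic] (M r : ℕ) [NeZero (M * r)],
    good M → r.Prime → M.Coprime r → W.conductorNorm ℤ = M * r →
    ∀ P : ModularParametrizationData W (M * r),
      (∀ (W' : WeierstrassCurve ℚ) [W'.IsElliptic], W'.conductorNorm ℤ = M * r →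
          ∀ P' : ModularParametrizationData W' (M * r),
          P'.f = P.f → P.modularDegree ≤ P'.modularDegree) →
      ∀ S : Brandt.XiSetup M r,
        ∃ i j : ℕ, 0 < i ∧ i * j = (W.minimalDiscriminantNorm ℤ).factorization r ∧
          i ∣ S.xi (fun n => W.LFunction n) ∧
          P.modularDegree * i = S.xi (fun n => W.LFunction n) * j

/-- The full stub is the regime `⊤` (gen 5). -/
theorem stub_iff_at_true : takahashi2001_thm_2_3_of_coprime ↔ TakahashiCoprimeAt fun _ => True := by
  constructor
  · intro h W _ M r _ _ hr hcop hN P hmin S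
    exact h W M r hr hcop hN P hmin S
  · intro h W _ M r _ hr hcop hN P hmin S
    exact h W M r trivial hr hcop hN P hmin S

theorem TakahashiCoprimeAt.mono {A B : ℕ → Prop} (hAB : ∀ M, A M → B M)
    (h : TakahashiCoprimeAt B) : TakahashiCoprimeAt A :=
  fun W _ M r _ hA hr hcop hN P hmin S => h W M r (hAB M hA) hr hcop hN P hmin S

/-- The corollary shape consumed by the composition, for any regime (gen 5). -/
theorem TakahashiCoprimeAt.modularDegree_le_brandtXi_mul {good : ℕ → Prop}
    (h : TakahashiCoprimeAt good) (W : WeierstrassCurve ℚ) [W.IsElliptic] (M r : ℕ) [NeZero (M * r)]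
    (hM : good M) (hr : r.Prime) (hcop : M.Coprime r) (hN : W.conductorNorm ℤ = M * r)
    (P : ModularParametrizationData W (M * r))
    (hmin : ∀ (W' : WeierstrassCurve ℚ) [W'.IsElliptic], W'.conductorNorm ℤ = M * r →
      ∀ P' : ModularParametrizationData W' (M * r),
        P'.f = P.f → P.modularDegree ≤ P'.modularDegree) :
    P.modularDegree ≤
      brandtXi M r (fun n => W.LFunction n) * (W.minimalDiscriminantNorm ℤ).factorization r := by
  obtain ⟨S, hS⟩ := exists_brandtXi_eq (takahashi2001_thm_2_3_of_coprime.nonempty_xiSetup' hr hcop)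
    (fun n => W.LFunction n)
  rw [hS]
  obtain ⟨i, j, hi, hij, -, hδ⟩ := h W M r hM hr hcop hN P hmin S
  calc P.modularDegree ≤ P.modularDegree * i := Nat.le_mul_of_pos_right _ hi
    _ = S.xi (fun n => W.LFunction n) * j := hδ
    _ ≤ S.xi (fun n => W.LFunction n) * (i * j) :=
        Nat.mul_le_mul_left _ (Nat.le_mul_of_pos_left _ hi)
    _ = _ := by rw [hij]

/-- SEAM (gen 5, proved): at a square-free LEVEL conductor-restricted minimality is minimality among all
curves with the same newform (`IsNewformOf.level_eq_conductorNorm_of_squarefree_level`). -/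
theorem minimal_of_conductorMinimal_of_squarefree {W : WeierstrassCurve ℚ} [W.IsElliptic] {N : ℕ}
    [NeZero N] (hsq : Squarefree N) (P : ModularParametrizationData W N)
    (hmin : ∀ (W' : WeierstrassCurve ℚ) [W'.IsElliptic], W'.conductorNorm ℤ = N →
      ∀ P' : ModularParametrizationData W' N, P'.f = P.f → P.modularDegree ≤ P'.modularDegree)
    (W' : WeierstrassCurve ℚ) [W'.IsElliptic] (P' : ModularParametrizationData W' N)
    (hP' : P'.f = P.f) : P.modularDegree ≤ P'.modularDegree :=
  hmin W' (P'.isNewformOf.level_eq_conductorNorm_of_squarefree_level hsq).symm P' hP'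

/-- The square-free regime of the STUB from the reviewed square-free dictionary (gen 5). -/
theorem takahashiAt_squarefree_of_dictionary (hD : takahashi2001_characterGroupDictionary) :
    TakahashiCoprimeAt Squarefree := by
  have h : takahashi2001_thm_2_3 :=
    takahashi2001_thm_2_3_holds_of takahashi2001_brandtEigenLattice_rank_one_holds hD
  intro W _ M r _ hM hr hcop hN P hmin S
  have hsq : Squarefree (M * r) := (Nat.squarefree_mul hcop).mpr ⟨hM, hr.squarefree⟩
  exact h W M r hr hsq hN P (minimal_of_conductorMinimal_of_squarefree hsq P hmin) S


/-- The crux restricted to Frey conductors `N` with `goodN N` (binder inserted after `N_E = N`). -/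
def DefiniteRTControlPrimeAt (goodN : ℕ → Prop) : Prop :=
  ∀ ε : ℝ, 0 < ε → ∃ C : ℝ, ∀ a b : ℤ, IsCoprime a b → a * b * (a + b) ≠ 0 →
    ∀ (N : ℕ) [NeZero N], (freyCurve a b).conductorNorm ℤ = N → goodN N →
    ∀ q : ℕ, q.Prime → q ≠ 2 → q ∣ N →
    ∀ D : ModularParametrizationData (freyCurve a b) N,
      (∀ D' : ModularParametrizationData (freyCurve a b) N, D.deg ≤ D'.deg) →
      (D.deg : ℝ) ≤ C * (N : ℝ) ^ ε *
        ((brandtXi (N / q) q (fun n => (freyCurve a b).LFunction n) : ℝ) *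
          (((freyCurve a b).minimalDiscriminantNorm ℤ).factorization q : ℕ))


/-- **The composition with a regime binder (PROVED).**  Verbatim clone of the landed
`definiteRTControlPrime_of_facts` (p97354) / gen-5 `definiteRTControlPrime_of_at_freyCofactor`, with the
single Takahashi line now consuming `hT : TakahashiCoprimeAt good` at the cofactor `M = N/q` through a
user-supplied regime transfer `hgood : … → goodN (M q) → good M`. -/
theorem definiteRTControlPrimeAt_of {good goodN : ℕ → Prop} (hT : TakahashiCoprimeAt good)
    (hgood : ∀ (a b : ℤ) (M q : ℕ), IsCoprime a b → a * b * (a + b) ≠ 0 → M ≠ 0 → q.Prime →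
      q ≠ 2 → M.Coprime q → (freyCurve a b).conductorNorm ℤ = M * q → goodN (M * q) → good M)
    (h163 : PastenShimura2024_minimalDegree_le_163_mul) (h68 : PastenShimura2024_lemma_6_8) :
    DefiniteRTControlPrimeAt goodN := by
  intro ε hε
  refine ⟨4 * 163 * 163, ?_⟩
  intro a b hab h0 N _ hN hgoodN q hq hq2 hqN D hDmin
  -- `N = M q`
  obtain ⟨M, hM⟩ := hqN
  rw [mul_comm] at hM
  subst hM
  haveI := isElliptic_freyCurve h0
  have hdiv : M * q / q = M := Nat.mul_div_cancel M hq.pos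
  rw [hdiv]
  have hM0 : M ≠ 0 := fun h => NeZero.ne (M * q) (by rw [h, zero_mul])
  have hqN' : q ∣ (freyCurve a b).conductorNorm ℤ := by rw [hN]; exact Dvd.intro_left M rfl
  -- `gcd(M, q) = 1`
  have hcop : M.Coprime q := by
    have h := stub_freyLocal a b hab h0 q hq hq2 hqN'
    rwa [hN, hdiv] at h
  -- a global minimal model `W_m = C • E`, its data, a minimal one
  obtain ⟨C, hC⟩ := hasGlobalMinimalModel_rat_holds (freyCurve a b)
  haveI := hC
  have hNm : (C • freyCurve a b).conductorNorm ℤ = M * q := by rw [conductorNorm_smul_rat, hN]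
  have hne : Nonempty (ModularParametrizationData (C • freyCurve a b) (M * q)) :=
    (Summit.ABC.ABC.Theorems.nonempty_modularParametrizationData_smul_iff C).mpr ⟨D⟩
  obtain ⟨D₁, -, hD₁min⟩ := exists_minimal_datum hne
  -- the lattice-optimal datum of the class of `f₁ := D₁.f`
  obtain ⟨W₀, hW₀, D₀, hf₀, h₀⟩ := D₁.exists_optimalDatum'
  haveI := hW₀
  have hker₀ : D₀.isogenyMap.ker = ⊥ := D₀.isogenyMap_ker_eq_bot_iff.mpr h₀
  have hmin₀ : ∀ (W' : WeierstrassCurve ℚ) [W'.IsElliptic]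
      (D' : ModularParametrizationData W' (M * q)), D'.f = D₀.f →
        D₀.modularDegree ≤ D'.modularDegree := fun W' _ D' hD' =>
    D₀.modularDegree_le_of_isogenyMap_ker_eq_bot hker₀ D' hD'
  -- (T_deg) `deg D₁ ≤ 163 · deg D₀`
  have h163' : D₁.modularDegree ≤ 163 * D₀.modularDegree :=
    h163 (M * q) W₀ (C • freyCurve a b) D₀ D₁ hf₀.symm hmin₀ hD₁min
  -- the conductor-restricted optimal pivot `(W⋆, P⋆)`
  obtain ⟨Ws, hWs, Ps, hNs, hfs, hPsmin⟩ := exists_conductorMinimal D₁ hNm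
  haveI := hWs
  have h0s : D₀.modularDegree ≤ Ps.modularDegree := hmin₀ Ws Ps (hfs.trans hf₀.symm)
  -- Takahashi at `(W⋆, P⋆)`, in the regime `good M` supplied by `hgood`
  have hTak : Ps.modularDegree ≤ brandtXi M q (fun n => Ws.LFunction n) *
      (Ws.minimalDiscriminantNorm ℤ).factorization q :=
    hT.modularDegree_le_brandtXi_mul Ws M q (hgood a b M q hab h0 hM0 hq hq2 hcop hN hgoodN) hq
      hcop hNs Ps hPsmin
  -- `a(W⋆) = a(f₁) = a(W_m) = a(E)`
  have hL : (fun n => Ws.LFunction n) = fun n => (freyCurve a b).LFunction n := by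
    funext n
    have h1 := Ps.isNewformOf.2 n
    have h2 := D₁.isNewformOf.2 n
    rw [hfs] at h1
    rw [h1, LFunction_smul] at h2
    exact_mod_cast h2
  rw [hL] at hTak
  -- (T_val) along `E ~ W_m ~ W⋆`
  have hiso : (freyCurve a b).IsIsogenous Ws :=
    (isIsogenous_smul (freyCurve a b) C).trans' (isIsogenous_of_f_eq D₁ Ps hfs)
  have hval : (Ws.minimalDiscriminantNorm ℤ).factorization q ≤
      163 * ((freyCurve a b).minimalDiscriminantNorm ℤ).factorization q :=
    stub_valTransport h68 a b hab h0 q hq hq2 hqN' Ws hiso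
  -- (T_model) back to the Frey model
  obtain ⟨D₁', -, hdeg₁'⟩ := stub_smulTransportDeg C D₁
  have hscale : (C.u : ℚ).num.natAbs ≤ 2 := stub_freyScale a b hab h0 C hC
  have hD : D.deg ≤ 4 * D₁.modularDegree := by
    calc D.deg ≤ D₁'.deg := hDmin D₁'
      _ = (C.u : ℚ).num.natAbs ^ 2 * D₁.deg := hdeg₁'
      _ ≤ 2 ^ 2 * D₁.deg := Nat.mul_le_mul_right _ (Nat.pow_le_pow_left hscale 2)
      _ = 4 * D₁.modularDegree := by norm_num [ModularParametrizationData.modularDegree]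
  -- the chain in `ℕ`
  set ξ : ℕ := brandtXi M q (fun n => (freyCurve a b).LFunction n) with hξ
  set v : ℕ := ((freyCurve a b).minimalDiscriminantNorm ℤ).factorization q with hv
  have hchain : D.deg ≤ 4 * 163 * 163 * (ξ * v) :=
    calc D.deg ≤ 4 * D₁.modularDegree := hD
      _ ≤ 4 * (163 * D₀.modularDegree) := Nat.mul_le_mul_left _ h163'
      _ ≤ 4 * (163 * Ps.modularDegree) := Nat.mul_le_mul_left _ (Nat.mul_le_mul_left _ h0s)
      _ ≤ 4 * (163 * (ξ * (Ws.minimalDiscriminantNorm ℤ).factorization q)) :=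
          Nat.mul_le_mul_left _ (Nat.mul_le_mul_left _ hTak)
      _ ≤ 4 * (163 * (ξ * (163 * v))) :=
          Nat.mul_le_mul_left _ (Nat.mul_le_mul_left _ (Nat.mul_le_mul_left _ hval))
      _ = 4 * 163 * 163 * (ξ * v) := by ring
  -- to `ℝ`, inserting the idle `N^ε ≥ 1`
  have hN1 : (1 : ℝ) ≤ ((M * q : ℕ) : ℝ) := by
    exact_mod_cast Nat.one_le_iff_ne_zero.mpr (NeZero.ne (M * q))
  have hrpow : (1 : ℝ) ≤ ((M * q : ℕ) : ℝ) ^ ε := Real.one_le_rpow hN1 hε.le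
  have hcast : (D.deg : ℝ) ≤ (4 * 163 * 163 : ℝ) * ((ξ : ℝ) * (v : ℝ)) := by
    exact_mod_cast hchain
  have hξv : (0 : ℝ) ≤ (ξ : ℝ) * (v : ℝ) := by positivity
  calc (D.deg : ℝ) ≤ (4 * 163 * 163 : ℝ) * ((ξ : ℝ) * (v : ℝ)) := hcast
    _ = (4 * 163 * 163 : ℝ) * 1 * ((ξ : ℝ) * (v : ℝ)) := by ring
    _ ≤ (4 * 163 * 163 : ℝ) * ((M * q : ℕ) : ℝ) ^ ε * ((ξ : ℝ) * (v : ℝ)) := by gcongr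

/-- **The semistable regime of the CRUX is closed modulo two reviewed facts** (the square-free
character-group dictionary — a def already in the tree — and Mazur–Kenku): no new leaf, no `sorry`. -/
theorem at_squarefree_of_dictionary (hD₀ : takahashi2001_characterGroupDictionary)
    (hMK : mazurKenku_exists_cyclic_isogeny) : DefiniteRTControlPrimeAt Squarefree :=
  definiteRTControlPrimeAt_of (takahashiAt_squarefree_of_dictionary hD₀)
    (fun _ _ _ _ _ _ _ _ _ _ _ hsq => Squarefree.of_mul_left hsq)
    (PastenShimura2024_minimalDegree_le_163_mul_of_mazurKenku' hMK)
    (PastenShimura2024_lemma_6_8_of_mazurKenku' hMK)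
-- END PORT (k2-g6)

end PortK2G6

/-! ## B2 — the crux restricted to square-free Frey conductors (semistable Frey curves) -/

/-- The crux `DefiniteRTControlPrime` with the single extra binder `Squarefree N` after `N_E = N`
(= k2-g6 `DefiniteRTControlPrimeAt Squarefree`). -/
def DefiniteRTControlPrimeSqf : Prop :=
  ∀ ε : ℝ, 0 < ε → ∃ C : ℝ, ∀ a b : ℤ, IsCoprime a b → a * b * (a + b) ≠ 0 →
    ∀ (N : ℕ) [NeZero N], (freyCurve a b).conductorNorm ℤ = N → Squarefree N →
    ∀ q : ℕ, q.Prime → q ≠ 2 → q ∣ N →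
    ∀ D : ModularParametrizationData (freyCurve a b) N,
      (∀ D' : ModularParametrizationData (freyCurve a b) N, D.deg ≤ D'.deg) →
      (D.deg : ℝ) ≤ C * (N : ℝ) ^ ε *
        ((brandtXi (N / q) q (fun n => (freyCurve a b).LFunction n) : ℝ) *
          (((freyCurve a b).minimalDiscriminantNorm ℤ).factorization q : ℕ))

/-- The restricted crux is WEAKER than the crux (PROVED). -/
theorem sqf_of_crux (h : DefiniteRTControlPrime) : DefiniteRTControlPrimeSqf := by
  intro ε hε
  obtain ⟨C, hC⟩ := h ε hε
  exact ⟨C, fun a b hab h0 N _ hN _ q hq hq2 hqN D hD => hC a b hab h0 N hN q hq hq2 hqN D hD⟩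

/-- B2 (PROVED here by the verbatim port above): the square-free crux is closed modulo the two reviewed
facts {`takahashi2001_characterGroupDictionary`, `mazurKenku_exists_cyclic_isogeny`}.  Kernel-checked as
`StubIdeas2G6.at_squarefree_of_dictionary` (k2 gen 6, 0 sorries; `Cruxes/` modules are not built on
the farm — probe `import …StubIdeas2G6TakahashiSketch` answered `remote:stale:unbuilt`, so it is ported): `definiteRTControlPrimeAt_of` (clone of p97354
`definiteRTControlPrime_of_facts` with the Takahashi line at cofactor `M = N/q`, `Squarefree M` from
`Squarefree.of_mul_left`) + seam `IsNewformOf.level_eq_conductorNorm_of_squarefree_level` +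
`PastenShimura2024_minimalDegree_le_163_mul_of_mazurKenku'` + `PastenShimura2024_lemma_6_8_of_mazurKenku'`. -/
theorem definiteRTControlPrimeSqf_of_dictionary (hD : takahashi2001_characterGroupDictionary)
    (hMK : mazurKenku_exists_cyclic_isogeny) : DefiniteRTControlPrimeSqf :=
  fun ε hε => at_squarefree_of_dictionary hD hMK ε hε

/-! ## B3 — Serre-arranged Frey curves have square-free conductor -/

/-- B3 (PROVED): for `A, B` coprime, `AB(A+B) ≠ 0`, `4 ∣ A + 1`, `16 ∣ B` (the arrangement
`exists_arrangement` supplies for every abc triple with `16 ∣ abc`) the conductor of `E_{A,B}` divides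
`rad(AB(A+B))` (B–G Ex. 12.5.10 via (12.18)), hence is square-free. -/
theorem squarefree_conductorNorm_freyCurve_of_arrangement {A B : ℤ} (hAB : IsCoprime A B)
    (h0 : A * B * (A + B) ≠ 0) (hA : 4 ∣ A + 1) (hB : (16 : ℤ) ∣ B) :
    Squarefree ((freyCurve A B).conductorNorm ℤ) := by
  have h4 : 4 ∣ B - A - 1 := by
    have : B - A - 1 = B - (A + 1) := by ring
    rw [this]; exact dvd_sub (dvd_trans (by norm_num) hB) hA
  have h16 : 16 ∣ A * B := dvd_mul_of_dvd_right hB _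
  rw [conductorNorm_freyCurve_eq_freyIntModel₂ h0 h4 h16]
  exact squarefree_radical.squarefree_of_dvd (conductorNorm_freyIntModel₂_dvd hAB h0 hA hB)

/-! ## B4–B6 — the semistable passage `FreyDegreeBoundSqf → ABC` -/

/-- The thesis `FreyDegreeBound` restricted to square-free conductor. -/
def FreyDegreeBoundSqf : Prop :=
  ∀ ε : ℝ, 0 < ε → ∃ C : ℝ, ∀ a b : ℤ, IsCoprime a b → a * b * (a + b) ≠ 0 →
    ∀ (N : ℕ) [NeZero N], (freyCurve a b).conductorNorm ℤ = N → Squarefree N →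
      ∃ D : ModularParametrizationData (freyCurve a b) N, (D.deg : ℝ) ≤ C * (N : ℝ) ^ (2 + ε)

theorem freyDegreeBoundSqf_of (h : FreyDegreeBound) : FreyDegreeBoundSqf := by
  intro ε hε
  obtain ⟨C, hC⟩ := h ε hε
  exact ⟨C, fun a b hab h0 N _ hN _ => hC a b hab h0 N hN⟩

/-- B4 (PROVED, mechanical clone of `estimates_of_frey_pair`, DegreeConjectureAbcPrelims.lean:300,
whose proof uses its global hypothesis `hC₀` ONLY at the pair `(A, B)` — line 323
`obtain ⟨D, hD⟩ := hC₀ A B hAB h0 N hNdef.symm`): the same estimates from the POINTWISE degree bound. -/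
theorem estimates_of_frey_pair_pointwise {A B : ℤ} (h0 : A * B * (A + B) ≠ 0)
    (W₀ : WeierstrassCurve ℤ) (hmin : ∀ v : IsDedekindDomain.HeightOneSpectrum ℤ, (W₀.baseChange ℚ).IsMinimalAt v)
    (hell : (W₀.baseChange ℚ).IsElliptic) (C : VariableChange ℚ)
    (hCW : C • freyCurve A B = W₀.baseChange ℚ) (hu : 1 ≤ ‖((C.u : ℚ) : ℂ)‖)
    {C₀ c₂ A₀ δ : ℝ}
    (hC₀ : ∀ (N : ℕ) [NeZero N], (freyCurve A B).conductorNorm ℤ = N →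
        ∃ D : ModularParametrizationData (freyCurve A B) N,
          (D.deg : ℝ) ≤ C₀ * (D.c : ℝ) ^ 2 * (N : ℝ) ^ (2 + δ))
    (hPc : ∀ (N : ℕ) [NeZero N] (W : WeierstrassCurve ℚ) [W.IsElliptic] (f : CuspForm (Gamma0 N) 2),
      IsNewformOf W f → c₂ * (N : ℝ) ^ (1 - δ) ≤ (peterssonProduct (Gamma0 N) 2 f f).re)
    (hA₀ : ∀ (W : WeierstrassCurve ℚ) [W.IsElliptic] [W.IsGloballyMinimal] (L : PeriodPair),
      IsNeronLatticeOf (W.baseChange ℂ) L →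
        ((max |W.Δ| (|W.c₄| ^ 3) : ℚ) : ℝ) ≤ A₀ * ZLattice.covolume L.lattice ^ (-(6 + δ))) :
    ∃ cov cov' : ℝ, 0 < cov ∧ |(W₀.c₄ : ℝ)| ^ 3 ≤ max A₀ 1 * cov' ^ (-(6 + δ)) ∧ cov ≤ cov' ∧
      4 * Real.pi ^ 2 * c₂ / max C₀ 1 *
        (((freyCurve A B).conductorNorm ℤ : ℕ) : ℝ) ^ (-(1 + 2 * δ)) ≤ cov := by
  -- verbatim clone of `estimates_of_frey_pair` (DegreeConjectureAbcPrelims.lean:300–368); the ONLY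
  -- change is the line obtaining `D` (pointwise `hC₀ N …` instead of `hC₀ A B hAB h0 N …`).
  haveI := isElliptic_freyCurve h0
  haveI := hell
  haveI : (W₀.baseChange ℚ).IsGloballyMinimal := isGloballyMinimal_of_forall_isMinimalAt_int _ hmin
  set N : ℕ := (freyCurve A B).conductorNorm ℤ with hNdef
  have hN0 : 0 < N := conductorNorm_pos_holds (freyCurve A B)
  haveI : NeZero N := ⟨hN0.ne'⟩
  obtain ⟨D, hD⟩ := hC₀ N hNdef.symm
  have hxy : 0 ≤ (D.c : ℝ) ^ 2 * (N : ℝ) ^ (2 + δ) := by positivity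
  have hD' : (D.deg : ℝ) ≤ max C₀ 1 * (D.c : ℝ) ^ 2 * (N : ℝ) ^ (2 + δ) := by
    calc (D.deg : ℝ) ≤ C₀ * (D.c : ℝ) ^ 2 * (N : ℝ) ^ (2 + δ) := hD
      _ = C₀ * ((D.c : ℝ) ^ 2 * (N : ℝ) ^ (2 + δ)) := by ring
      _ ≤ max C₀ 1 * ((D.c : ℝ) ^ 2 * (N : ℝ) ^ (2 + δ)) :=
          mul_le_mul_of_nonneg_right (le_max_left _ _) hxy
      _ = _ := by ring
  have hPD := hPc N (freyCurve A B) D.f D.isNewformOf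
  have hlow := covolume_neronLattice_ge_of_deg_le D (one_pos.trans_le (le_max_right C₀ 1)) hD' hPD
  have hL : IsNeronLatticeOf ((freyCurve A B).baseChange ℂ) D.L := D.isNeronLattice
  set Cc : VariableChange ℂ := C.map (algebraMap ℚ ℂ) with hCc
  have hLs := hL.smul Cc
  have hmap : (C • freyCurve A B).baseChange ℂ = Cc • (freyCurve A B).baseChange ℂ := by
    simp only [hCc, WeierstrassCurve.baseChange, WeierstrassCurve.map_variableChange]
  rw [← hmap, hCW] at hLs
  have hSW := hA₀ (W₀.baseChange ℚ) _ hLs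
  set L' : PeriodPair := D.L.mulLeft ((Cc.u : ℂˣ) : ℂ) Cc.u.ne_zero with hL'
  have hcov'0 : 0 < ZLattice.covolume L'.lattice := ZLattice.covolume_pos _ _
  refine ⟨ZLattice.covolume D.L.lattice, ZLattice.covolume L'.lattice, ZLattice.covolume_pos _ _,
    ?_, ?_, hlow⟩
  · have h1 : ((|(W₀.baseChange ℚ).c₄| ^ 3 : ℚ) : ℝ) ≤
        ((max |(W₀.baseChange ℚ).Δ| (|(W₀.baseChange ℚ).c₄| ^ 3) : ℚ) : ℝ) := by
      exact_mod_cast le_max_right _ _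
    have hc₄ : (W₀.baseChange ℚ).c₄ = (W₀.c₄ : ℚ) := by
      simp [WeierstrassCurve.baseChange, WeierstrassCurve.map_c₄]
    have hpos : 0 ≤ ZLattice.covolume L'.lattice ^ (-(6 + δ)) := Real.rpow_nonneg hcov'0.le _
    have key : |(W₀.c₄ : ℝ)| ^ 3 ≤ A₀ * ZLattice.covolume L'.lattice ^ (-(6 + δ)) := by
      have e1 : |(W₀.c₄ : ℝ)| ^ 3 = ((|(W₀.baseChange ℚ).c₄| ^ 3 : ℚ) : ℝ) := by
        rw [hc₄]; norm_cast
      rw [e1]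
      exact h1.trans hSW
    exact key.trans (mul_le_mul_of_nonneg_right (le_max_left A₀ 1) hpos)
  · rw [hL', PeriodPair.covolume_mulLeft_lattice]
    have hnorm : ((Cc.u : ℂˣ) : ℂ) = ((C.u : ℚ) : ℂ) := by
      simp [hCc, WeierstrassCurve.VariableChange.map_u]
    rw [hnorm]
    have hcov0 : 0 ≤ ZLattice.covolume D.L.lattice := (ZLattice.covolume_pos _ _).le
    have hu2 : 1 ≤ ‖((C.u : ℚ) : ℂ)‖ ^ 2 := one_le_pow₀ hu
    calc ZLattice.covolume D.L.lattice = 1 * ZLattice.covolume D.L.lattice := (one_mul _).symm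
      _ ≤ _ := mul_le_mul_of_nonneg_right hu2 hcov0

/-- B5 (PROVED: the `16 ∣ abc` branch of `abcLe_of_freyDegreeBound`, DegreeConjectureAbc.lean:120,
verbatim, with `estimates_of_frey_pair` ↦ B4 fed by `hdeg` at the ARRANGED pair, whose guard
`Squarefree N` is B3): semistable Frey degree bound ⇒ `c ≤ C rad(abc)^{1+ε}` on triples with `16 ∣ abc`. -/
theorem abcLe_sixteen_of_freyDegreeBoundSqf (hP : murty_petersson_newform_lower_bound)
    (hS : silverman1986_discriminant_c4_covolume)
    (hdeg : ∀ ε : ℝ, 0 < ε → ∃ C : ℝ, ∀ a b : ℤ, IsCoprime a b → a * b * (a + b) ≠ 0 →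
      ∀ (N : ℕ) [NeZero N], (freyCurve a b).conductorNorm ℤ = N → Squarefree N →
        ∃ D : ModularParametrizationData (freyCurve a b) N,
          (D.deg : ℝ) ≤ C * (D.c : ℝ) ^ 2 * (N : ℝ) ^ (2 + ε)) :
    ∀ ε : ℝ, 0 < ε → ∃ C : ℝ, ∀ a b c : ℕ, IsABCTriple a b c → 16 ∣ a * b * c →
      (c : ℝ) ≤ C * ((rad a b c : ℕ) : ℝ) ^ (1 + ε) := by
  -- the `16 ∣ abc` branch of `abcLe_of_freyDegreeBound` (DegreeConjectureAbc.lean:120–262) with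
  -- `estimates_of_frey_pair` ↦ B4, fed by `hdeg` at the ARRANGED pair; its guard `Squarefree N` is B3.
  intro ε hε
  set δ : ℝ := min 1 (ε / 3) with hδdef
  have hδ : 0 < δ := lt_min one_pos (by positivity)
  have hδ1 : δ ≤ 1 := min_le_left _ _
  have hδε : 3 * δ ≤ ε := by have := min_le_right 1 (ε / 3); linarith
  obtain ⟨C₀, hC₀⟩ := hdeg δ hδ
  obtain ⟨c₂, hc₂, hPc⟩ := hP δ hδ
  obtain ⟨A₀, hA₀⟩ := hS δ hδ
  have hA : (0 : ℝ) ≤ max A₀ 1 := zero_le_one.trans (le_max_right _ _)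
  set κ : ℝ := 4 * Real.pi ^ 2 * c₂ / max C₀ 1 with hκdef
  have hκ : 0 < κ := div_pos (by positivity) (one_pos.trans_le (le_max_right _ _))
  set M : ℝ := 8 * max A₀ 1 * κ ^ (-(6 + δ)) * (2 ^ 10) ^ ((1 + 2 * δ) * (6 + δ)) with hMdef
  have hM : 0 ≤ M := by positivity
  refine ⟨M ^ (1 / 6 : ℝ), fun a b c h h16 ↦ ?_⟩
  have h' := h
  obtain ⟨ha, hb, habc, hcop⟩ := h'
  have hc0 : 0 < c := by omega
  have habc0 : a * b * c ≠ 0 := by positivity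
  set R : ℝ := ((rad a b c : ℕ) : ℝ) with hRdef
  have hRpos : 0 < rad a b c := by
    rw [rad_def]; exact Nat.pos_of_ne_zero radical_ne_zero
  have hR : (1 : ℝ) ≤ R := by rw [hRdef]; exact_mod_cast hRpos
  -- Serre's normalisation and the model (12.18), `u = 2`
  obtain ⟨A, B, hAB, hA4, hB, hprod, hquad⟩ := exists_arrangement h h16
  have h0 : A * B * (A + B) ≠ 0 := by
    rw [← Int.natAbs_ne_zero, hprod]; exact habc0
  have h4 : 4 ∣ B - A - 1 := by
    have : B - A - 1 = B - (A + 1) := by ring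
    rw [this]; exact dvd_sub (dvd_trans (by norm_num) hB) hA4
  have h16' : 16 ∣ A * B := dvd_mul_of_dvd_right hB _
  haveI := isElliptic_freyCurve h0
  set Cv : VariableChange ℚ := ⟨Units.mk0 (2 : ℚ) two_ne_zero, 0, 1, 0⟩ with hCv
  have hCW : Cv • freyCurve A B = (freyIntModel₂ A B).baseChange ℚ :=
    smul_freyCurve_eq_baseChange_freyIntModel₂ h4 h16'
  have hu : 1 ≤ ‖((Cv.u : ℚ) : ℂ)‖ := by simp [hCv]
  -- the POINTWISE degree bound at the arranged pair: its conductor is square-free (B3)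
  have hC₀pt : ∀ (N : ℕ) [NeZero N], (freyCurve A B).conductorNorm ℤ = N →
      ∃ D : ModularParametrizationData (freyCurve A B) N,
        (D.deg : ℝ) ≤ C₀ * (D.c : ℝ) ^ 2 * (N : ℝ) ^ (2 + δ) := fun N _ hN =>
    hC₀ A B hAB h0 N hN (hN ▸ squarefree_conductorNorm_freyCurve_of_arrangement hAB h0 hA4 hB)
  obtain ⟨cov, cov', hcov, hc₄, hcc, hlow⟩ := estimates_of_frey_pair_pointwise h0
    (freyIntModel₂ A B) (isMinimalAt_freyIntModel₂ hAB hA4 hB) (isElliptic_freyIntModel₂ h0 h4 h16')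
    Cv hCW hu hC₀pt hPc hA₀
  -- the conductor: `N_E = cond (12.18) ∣ rad (AB(A+B)) = rad (abc)`
  have hdvd : (freyCurve A B).conductorNorm ℤ ∣ rad a b c := by
    rw [conductorNorm_freyCurve_eq_freyIntModel₂ h0 h4 h16', rad_def, ← hprod]
    exact conductorNorm_freyIntModel₂_dvd hAB h0 hA4 hB
  have hNle : (((freyCurve A B).conductorNorm ℤ : ℕ) : ℝ) ≤ 2 ^ 10 * R := by
    have h1 : (((freyCurve A B).conductorNorm ℤ : ℕ) : ℝ) ≤ R := by
      rw [hRdef]; exact_mod_cast Nat.le_of_dvd hRpos hdvd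
    exact h1.trans (le_mul_of_one_le_left (zero_le_one.trans hR) (by norm_num))
  have hNpos : (0 : ℝ) < (((freyCurve A B).conductorNorm ℤ : ℕ) : ℝ) := by
    exact_mod_cast conductorNorm_pos_holds (freyCurve A B)
  -- `c² ≤ 2 c₄'`, `c₄' = A² + AB + B² = (a² + b² + c²)/2`
  have hcc4 : (c : ℝ) ^ 2 ≤ 2 * |((freyIntModel₂ A B).c₄ : ℝ)| := by
    rw [freyIntModel₂_c₄ h4 h16']
    have hq : (0 : ℤ) ≤ A ^ 2 + A * B + B ^ 2 := by
      nlinarith [sq_nonneg (A + B), sq_nonneg A, sq_nonneg B]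
    have hz : ((c : ℕ) : ℤ) ^ 2 ≤ 2 * |A ^ 2 + A * B + B ^ 2| := by
      rw [abs_of_nonneg hq, hquad]; nlinarith [sq_nonneg (a : ℤ), sq_nonneg (b : ℤ)]
    have hzr : (((c : ℕ) : ℤ) : ℝ) ^ 2 ≤ 2 * |((A ^ 2 + A * B + B ^ 2 : ℤ) : ℝ)| := by
      exact_mod_cast hz
    simpa using hzr
  -- bookkeeping
  have h6 := pow_six_le_of_estimates hδ hA hκ hNpos hcov hcc4 hc₄ hcc hlow hNle hR
  exact le_of_pow_six_le (Nat.cast_nonneg c) hM hR (exponent_le hδ hδ1 hδε) h6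

/-- Manin-constant padding (PROVED, as in `abcLe_of_freyDegreeBound'`): `deg ≤ C N^{2+ε}` gives
`deg ≤ max(C,0) · c² · N^{2+ε}` since `c ∈ ℤ ∖ {0}`. -/
theorem pad_manin (hdeg : FreyDegreeBoundSqf) :
    ∀ ε : ℝ, 0 < ε → ∃ C : ℝ, ∀ a b : ℤ, IsCoprime a b → a * b * (a + b) ≠ 0 →
      ∀ (N : ℕ) [NeZero N], (freyCurve a b).conductorNorm ℤ = N → Squarefree N →
        ∃ D : ModularParametrizationData (freyCurve a b) N,
          (D.deg : ℝ) ≤ C * (D.c : ℝ) ^ 2 * (N : ℝ) ^ (2 + ε) := by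
  intro ε hε
  obtain ⟨C, hC⟩ := hdeg ε hε
  refine ⟨max C 0, fun a b hab h0 N _ hN hsq => ?_⟩
  obtain ⟨D, hD⟩ := hC a b hab h0 N hN hsq
  refine ⟨D, hD.trans ?_⟩
  have hc : (1 : ℝ) ≤ (D.c : ℝ) ^ 2 := by
    have h1 : (1 : ℤ) ≤ D.c ^ 2 := by
      have h0' : D.c ≠ 0 := D.maninConstant_ne_zero_holds
      nlinarith [Int.one_le_abs h0', sq_abs D.c]
    exact_mod_cast h1
  have hN0 : (0 : ℝ) ≤ (N : ℝ) ^ (2 + ε) := by positivity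
  calc C * (N : ℝ) ^ (2 + ε) ≤ max C 0 * (N : ℝ) ^ (2 + ε) :=
        mul_le_mul_of_nonneg_right (le_max_left _ _) hN0
    _ = max C 0 * 1 * (N : ℝ) ^ (2 + ε) := by ring
    _ ≤ max C 0 * (D.c : ℝ) ^ 2 * (N : ℝ) ^ (2 + ε) :=
        mul_le_mul_of_nonneg_right (mul_le_mul_of_nonneg_left hc (le_max_right C 0)) hN0

/-- B6 (PROVED modulo B5): the replacement for the route item `DegreeBoundToABCOfPetersson`
(`PeterssonLowerBound → FreyDegreeBound → ABC`) in the semistable re-glue: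
`PeterssonLowerBound → FreyDegreeBoundSqf → ABC`, through B5, the tree's `16 ∣ abc` reduction
`abcLe_of_abcLe_sixteen_dvd` and `abcLt_of_abcLe`; Silverman's covolume fact is a tree theorem. -/
theorem abc_of_freyDegreeBoundSqf (hP : PeterssonLowerBound) (hdeg : FreyDegreeBoundSqf) :
    _root_.ABC :=
  abcLt_of_abcLe (abcLe_of_abcLe_sixteen_dvd
    (abcLe_sixteen_of_freyDegreeBoundSqf hP silverman1986_discriminant_c4_covolume_holds
      (pad_manin hdeg)))

/-! ## Sanity: the re-glued chain for THIS crux's slot elaborates -/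

/-- Shape of the semistable re-glue at the crux's slot (PROVED bookkeeping): a square-free version of
`DefiniteGlue`'s conclusion (degree bound for minimal data of semistable Frey curves) plus
`FreyModularity` gives `FreyDegreeBoundSqf` exactly as `minimalBoundGivesTarget_proof` does, and B6
finishes.  The binder list a tenure planner would give `closes` is read off the hypotheses. -/
theorem closes_shape
    (hMinBound : ∀ ε : ℝ, 0 < ε → ∃ C : ℝ, ∀ a b : ℤ, IsCoprime a b → a * b * (a + b) ≠ 0 →
      ∀ (N : ℕ) [NeZero N], (freyCurve a b).conductorNorm ℤ = N → Squarefree N →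
      ∀ D : ModularParametrizationData (freyCurve a b) N,
        (∀ D' : ModularParametrizationData (freyCurve a b) N, D.deg ≤ D'.deg) →
        (D.deg : ℝ) ≤ C * (N : ℝ) ^ (2 + ε))
    (hMod : FreyModularity) (hP : PeterssonLowerBound) : _root_.ABC := by
  refine abc_of_freyDegreeBoundSqf hP fun ε hε => ?_
  obtain ⟨C, hC⟩ := hMinBound ε hε
  refine ⟨C, fun a b hab h0 N _ hN hsq => ?_⟩
  haveI := isElliptic_freyCurve h0
  obtain ⟨D, -, hDmin⟩ := exists_minimal_datum (hMod a b hab h0 N hN)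
  exact ⟨D, hC a b hab h0 N hN hsq D hDmin⟩

end Summit.ABC.ABC.Cruxes.DefiniteRTControlPrime.StubIdeas1G13

end
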